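import Summits.CriticalPhenomena.PercolationContinuityZ3.Theorems.PercNearOneGluingNoHeavyLowerTailW0NonHubSwap
import HarnessLib

/-!
# Cascades of switching maps, and the `a`-cluster keep map `K_a` (the hub-side companion of `T0`)

Support file for crux `stmt-CriticalPhenomena-4575` (`NoHeavyLowerTail`), seat `prim-l12-p1` gen 14
(`--supports stmt-CriticalPhenomena-4575`); memo `run/shared/lean/prim/prim-l12/FROM-prim-l12-p1-g14-SWITCHING-MAP-ANATOMY.md`.
It continues `…W0NonHubSwap` (gen 13: the three-region swap `T0` settles the NON-HUB part of the two-link deficit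
row `W0`, `P(ab|c|y)·P(a|b|cy) ≤ P(ab|cy)·[P(∅)+P(ab|c|y)] + P(∅)·[P(a|bcy)+P(acy|b)]`, on every finite graph).

Setting: pairs `(C₁, C₂)` of bond configurations inside a finite edge set `D ⊆ Sym2 V` with arbitrary edge
probabilities (finitary calculus `DecisionTree.Pr2W`), four vertices `a b c y`.

1. `Pr2W_le_of_injOn` — **the cascade principle**: a map that is injective on a source event, weight-preserving there
   and sends it into a target event bounds `P⊗P(source) ≤ P⊗P(target)`; `Pr2W_le_of_two_maps` — two injective
   weight-preserving maps with DISJOINT image classes combine into one such injection (this is how `T0` on the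
   non-hub pairs and a second map on hub pairs are glued without any Hall-type bookkeeping).
2. `kaMap` — the map `K_a (C₁,C₂) = (C₁ on F, C₂ off F ; C₂ on F, C₁ off F)` with `F = Ē(cl_{C₂} a)` (keep the two
   configurations on the edge region of the `C₂`-cluster of `a`, exchange them elsewhere; Gladkov–Zimin cluster
   switching with the region read from the SECOND configuration).  It is a weight-preserving INVOLUTION
   (`kaMap_kaMap`), hence injective.  Structural facts, for every pair: the second image configuration has
   `a`-cluster exactly `cl_{C₂} a` (`clus_kaMap_snd_a`) and, off that cluster, exactly the `C₁`-connectivity avoiding it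
   (`ClusterRegion.reachable_splice_iff_avoid`); the first image configuration keeps every other `C₂`-cluster
   connected.  Consequently (`kaMap_mem_target`) `K_a` maps
   `{C₂ : y ∈ cl c ∌ a, b ∉ cl a} × {C₁ : b, c, y pairwise separated}` into `{C₃ : y ∈ cl c} × {C₄ : a,b,c,y pairwise separated}`
   — on the hub pairs of `W0` this is the map whose second coordinate is ALWAYS the bottom cell (memo §2, L2.1).
3. `Pr2W_src_le` — the resulting inequality `P⊗P(source) ≤ P(c ↔ y)·P(a|b|c|y)` for every finite weighted graph (at law
   level this particular inequality is also a consequence of Harris' inequality applied twice — memo §3c; it is recorded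
   as the image certificate of `K_a`), and `Pr2W_nonHub_union_aSep_le` — **the two-map cascade `T0 ⊔ K_a`**: the pairs of
   `{C₁ ∈ ab|c|y} × {C₂ ∈ a|b|cy}` that are non-hub OR whose `K_a`-image lies in the cell `(acy|b ; a|b|c|y)` have total
   weight at most `P⊗P(targetEvent of T0) + P(acy|b-cell)·P(bottom cell)`, i.e. `W0` holds for them with room to spare;
   what remains of `W0` for all `n` is the complementary 'residual' class of hub pairs (memo §2–§6).
All statements are for ALL finite graphs; no computation, no named facts.
-/

noncomputable section

open Classical

namespace Summit.CriticalPhenomena.PercolationContinuityZ3.Theorems.W0KeepClusterSwap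

open Finset
open Literature.Probability.Percolation
open Literature.Probability.Percolation.DecisionTree
open Literature.Probability.Percolation.ClusterRegion
open Summit.CriticalPhenomena.PercolationContinuityZ3.Theorems.W0NonHubSwap

/-! ## 1. The cascade principle: partial injections and gluing two maps -/

section Cascade

variable {ι : Type*} [DecidableEq ι]

/-- `Pr2W` as a plain sum of weights over the pairs inside `E` that belong to the event. [folklore] -/
theorem Pr2W_eq_sum_filter (E : Finset ι) (p : ι → ℝ) (Y : Set (Finset ι × Finset ι)) :
    Pr2W E p Y = ∑ x ∈ (E.powerset ×ˢ E.powerset).filter (fun x => x ∈ Y), wt2W E p x := by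
  rw [Pr2W_eq_sum_ind, Finset.sum_filter]
  refine Finset.sum_congr rfl fun x _ => ?_
  by_cases hx : x ∈ Y
  · rw [ind_of_mem hx, if_pos hx, mul_one]
  · rw [ind_of_not_mem hx, if_neg hx, mul_zero]

/-- **Cascade principle (one map).**  If `Ψ` is injective on the pairs of `S` inside `E`, preserves their weights
and maps them to pairs of `Y` inside `E`, then `P⊗P(S) ≤ P⊗P(Y)`.  (The image of `S` is a sub-family of `Y` of the
same total weight.) [cite: Gladkov2024, Lemma 3.1 (measure-preserving maps of pairs); this form: this work] -/
theorem Pr2W_le_of_injOn (E : Finset ι) {p : ι → ℝ} (hp0 : ∀ i, 0 ≤ p i) (hp1 : ∀ i, p i ≤ 1)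
    (Ψ : Finset ι × Finset ι → Finset ι × Finset ι) (S Y : Set (Finset ι × Finset ι))
    (hw : ∀ x ∈ E.powerset ×ˢ E.powerset, x ∈ S → wt2W E p (Ψ x) = wt2W E p x)
    (hmaps : ∀ x ∈ E.powerset ×ˢ E.powerset, x ∈ S → Ψ x ∈ E.powerset ×ˢ E.powerset ∧ Ψ x ∈ Y)
    (hinj : Set.InjOn Ψ {x | x ∈ E.powerset ×ˢ E.powerset ∧ x ∈ S}) :
    Pr2W E p S ≤ Pr2W E p Y := by
  set A := (E.powerset ×ˢ E.powerset).filter (fun x => x ∈ S) with hA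
  have hinjA : Set.InjOn Ψ ↑A := by
    intro x hx x' hx' h
    rw [Finset.mem_coe, hA, Finset.mem_filter] at hx hx'
    exact hinj ⟨hx.1, hx.2⟩ ⟨hx'.1, hx'.2⟩ h
  have h1 : Pr2W E p S = ∑ z ∈ A.image Ψ, wt2W E p z := by
    rw [Pr2W_eq_sum_filter, Finset.sum_image fun x hx x' hx' h => hinjA hx hx' h]
    refine Finset.sum_congr rfl fun x hx => ?_
    rw [hA, Finset.mem_filter] at hx
    rw [hw x hx.1 hx.2]
  have hsub : A.image Ψ ⊆ (E.powerset ×ˢ E.powerset).filter (fun z => z ∈ Y) := by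
    intro z hz
    obtain ⟨x, hx, rfl⟩ := Finset.mem_image.1 hz
    rw [hA, Finset.mem_filter] at hx
    exact Finset.mem_filter.2 (hmaps x hx.1 hx.2)
  rw [h1, Pr2W_eq_sum_filter]
  exact Finset.sum_le_sum_of_subset_of_nonneg hsub fun z _ _ => wt2W_nonneg E hp0 hp1 z

/-- **Cascade principle (two maps).**  Two weight-preserving injective self-maps `M₁, M₂` of the pair space and two
DISJOINT classes `C₁, C₂`: if every pair of `S` is sent into `C₁` by `M₁` or into `C₂` by `M₂`, then
`P⊗P(S) ≤ P⊗P(C₁ ∪ C₂)` — use `M₁` when it lands in `C₁`, else `M₂`; disjointness of the classes makes the glued map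
injective. [this work] -/
theorem Pr2W_le_of_two_maps (E : Finset ι) {p : ι → ℝ} (hp0 : ∀ i, 0 ≤ p i) (hp1 : ∀ i, p i ≤ 1)
    (M₁ M₂ : Finset ι × Finset ι → Finset ι × Finset ι) (C₁ C₂ S : Set (Finset ι × Finset ι))
    (hdisj : Disjoint C₁ C₂)
    (hw₁ : ∀ x, wt2W E p (M₁ x) = wt2W E p x) (hw₂ : ∀ x, wt2W E p (M₂ x) = wt2W E p x)
    (hmaps₁ : ∀ x ∈ E.powerset ×ˢ E.powerset, M₁ x ∈ E.powerset ×ˢ E.powerset)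
    (hmaps₂ : ∀ x ∈ E.powerset ×ˢ E.powerset, M₂ x ∈ E.powerset ×ˢ E.powerset)
    (hinj₁ : Function.Injective M₁) (hinj₂ : Function.Injective M₂)
    (hcover : ∀ x ∈ E.powerset ×ˢ E.powerset, x ∈ S → M₁ x ∈ C₁ ∨ M₂ x ∈ C₂) :
    Pr2W E p S ≤ Pr2W E p (C₁ ∪ C₂) := by
  let Ψ : Finset ι × Finset ι → Finset ι × Finset ι := fun x => if M₁ x ∈ C₁ then M₁ x else M₂ x
  have hΨ : ∀ x, (M₁ x ∈ C₁ ∧ Ψ x = M₁ x) ∨ (M₁ x ∉ C₁ ∧ Ψ x = M₂ x) := by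
    intro x
    by_cases h : M₁ x ∈ C₁
    · exact Or.inl ⟨h, if_pos h⟩
    · exact Or.inr ⟨h, if_neg h⟩
  refine Pr2W_le_of_injOn E hp0 hp1 Ψ S (C₁ ∪ C₂) ?_ ?_ ?_
  · intro x _ _
    rcases hΨ x with ⟨-, h⟩ | ⟨-, h⟩
    · rw [h, hw₁]
    · rw [h, hw₂]
  · intro x hx hxS
    rcases hΨ x with ⟨h1, h⟩ | ⟨h1, h⟩
    · rw [h]; exact ⟨hmaps₁ x hx, Or.inl h1⟩
    · rw [h]
      rcases hcover x hx hxS with h2 | h2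
      · exact absurd h2 h1
      · exact ⟨hmaps₂ x hx, Or.inr h2⟩
  · intro x hx x' hx' hxx'
    have cov := hcover x hx.1 hx.2
    have cov' := hcover x' hx'.1 hx'.2
    rcases hΨ x with ⟨h1, h⟩ | ⟨h1, h⟩ <;> rcases hΨ x' with ⟨h1', h'⟩ | ⟨h1', h'⟩
    · rw [h, h'] at hxx'; exact hinj₁ hxx'
    · -- `M₁ x ∈ C₁` but `Ψ x' = M₂ x' ∈ C₂`: impossible by disjointness
      rw [h, h'] at hxx'
      have h2' : M₂ x' ∈ C₂ := by rcases cov' with h2 | h2; exact absurd h2 h1'; exact h2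
      exact absurd (hxx' ▸ h1) (Set.disjoint_right.1 hdisj h2')
    · rw [h, h'] at hxx'
      have h2 : M₂ x ∈ C₂ := by rcases cov with h2 | h2; exact absurd h2 h1; exact h2
      exact absurd (hxx'.symm ▸ h1') (Set.disjoint_right.1 hdisj h2)
    · rw [h, h'] at hxx'; exact hinj₂ hxx'

end Cascade

/-! ## 2. The map `K_a`: keep on the edge region of `cl_{C₂}(a)`, exchange elsewhere -/

variable {V : Type*} [Fintype V] [DecidableEq V]

/-- The region of `K_a`: the edge region `Ē(cl_{C₂} a)` of the `C₂`-cluster of `a`. [this work] -/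
def kaRegion (D : Finset (Sym2 V)) (a : V) (x : Finset (Sym2 V) × Finset (Sym2 V)) : Finset (Sym2 V) :=
  edgeReg D (clus D x.2 a)

/-- The map `K_a (C₁, C₂) = (C₁ on F ∪ C₂ off F, C₂ on F ∪ C₁ off F)`, `F = Ē(cl_{C₂} a)`: the two configurations
are KEPT on the edge region of the `C₂`-cluster of `a` and EXCHANGED elsewhere. [this work] -/
def kaMap (D : Finset (Sym2 V)) (a : V) (x : Finset (Sym2 V) × Finset (Sym2 V)) :
    Finset (Sym2 V) × Finset (Sym2 V) :=
  (splice (kaRegion D a x) x.1 x.2, splice (kaRegion D a x) x.2 x.1)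

variable {D : Finset (Sym2 V)} {a : V}

/-- The second image configuration has the same `a`-cluster as `C₂`: `cl_{C₄} a = cl_{C₂} a` (sealed island).
[cite: GladkovZimin2024, proof of Thm. 4.6 (sealed island); this form: this work] -/
theorem clus_kaMap_snd_a (x : Finset (Sym2 V) × Finset (Sym2 V)) :
    clus D (kaMap D a x).2 a = clus D x.2 a :=
  clus_splice_eq (K := x.2) (ω := x.1) (mem_clus_self a)

/-- The region is read off the image: `kaRegion (K_a x) = kaRegion x`. [this work] -/
theorem kaRegion_kaMap (x : Finset (Sym2 V) × Finset (Sym2 V)) :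
    kaRegion D a (kaMap D a x) = kaRegion D a x := by
  unfold kaRegion
  rw [clus_kaMap_snd_a]

/-- `K_a` is an involution; in particular it is injective. [this work] -/
theorem kaMap_kaMap (x : Finset (Sym2 V) × Finset (Sym2 V)) : kaMap D a (kaMap D a x) = x := by
  obtain ⟨x1, x2⟩ := x
  have h := kaRegion_kaMap (D := D) (a := a) (x1, x2)
  unfold kaMap at h ⊢
  rw [h, splice_splice_left, splice_splice_left]

/-- `K_a` is injective. [this work] -/
theorem kaMap_injective : Function.Injective (kaMap D a) :=
  Function.LeftInverse.injective (g := kaMap D a) kaMap_kaMap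

/-- `K_a` preserves the pair weight. [cite: Gladkov2024, Lemma 3.1 (= GZ24 Lemma 4.2)] -/
theorem wt2W_kaMap (p : Sym2 V → ℝ) (x : Finset (Sym2 V) × Finset (Sym2 V)) :
    wt2W D p (kaMap D a x) = wt2W D p x := by
  unfold wt2W kaMap
  exact wtW_splice_mul_wtW_splice D p (kaRegion D a x) x.1 x.2

/-- `K_a` maps pairs inside `D` to pairs inside `D`. [this work] -/
theorem kaMap_mem_pairs {x : Finset (Sym2 V) × Finset (Sym2 V)} (hx : x ∈ D.powerset ×ˢ D.powerset) :
    kaMap D a x ∈ D.powerset ×ˢ D.powerset := by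
  rw [mem_product, mem_powerset, mem_powerset] at hx ⊢
  exact ⟨splice_subset hx.1 hx.2, splice_subset hx.2 hx.1⟩

omit [Fintype V] [DecidableEq V] in
/-- Monotonicity of reachability in the open graph of a finite configuration. [folklore] -/
private theorem reachable_mono' {M M' : Finset (Sym2 V)} (h : M ⊆ M') {u w : V}
    (hr : (openGraph (↑M : Set (Sym2 V))).Reachable u w) :
    (openGraph (↑M' : Set (Sym2 V))).Reachable u w :=
  hr.mono (openGraph_mono (Finset.coe_subset.2 h))

/-- **Off the island, the second image configuration is `C₁` avoiding it**: for `u ∉ cl_{C₂} a`, if `u ~ w` in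
`C₄ = (K_a x).2` then `u ~ w` in `C₁` (indeed by `C₁`-open edges of `D` touching no vertex of `cl_{C₂} a`).
[cite: GladkovZimin2024, proof of Thm. 4.6 ("S̄₃ contains a cut"); this form: this work] -/
theorem reach_fst_of_reach_kaMap_snd {x : Finset (Sym2 V) × Finset (Sym2 V)} {u w : V}
    (hu : u ∉ clus D x.2 a) (h : (openGraph (↑((kaMap D a x).2 ∩ D) : Set (Sym2 V))).Reachable u w) :
    (openGraph (↑(x.1 ∩ D) : Set (Sym2 V))).Reachable u w := by
  have h' := (reachable_splice_iff_avoid (K := x.2) (ω := x.1) hu).1 h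
  refine reachable_mono' (fun e he => ?_) h'
  obtain ⟨⟨he1, heD⟩, -⟩ := mem_avoid.1 he
  exact mem_inter.2 ⟨he1, heD⟩

/-- In the second image configuration a vertex outside `cl_{C₂} a` is joined only to vertices it is joined to in
`C₁`: `w ∈ cl_{C₄} u → w ∈ cl_{C₁} u` for `u ∉ cl_{C₂} a`. [this work] -/
theorem mem_clus_fst_of_mem_clus_kaMap_snd {x : Finset (Sym2 V) × Finset (Sym2 V)} {u w : V}
    (hu : u ∉ clus D x.2 a) (h : w ∈ clus D (kaMap D a x).2 u) : w ∈ clus D x.1 u :=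
  mem_clus.2 (reach_fst_of_reach_kaMap_snd hu (mem_clus.1 h))

/-- **The other `C₂`-clusters survive in the first image configuration**: for `u ∉ cl_{C₂} a`,
`cl_{C₂} u ⊆ cl_{C₃} u` with `C₃ = (K_a x).1`. [cite: GladkovZimin2024, proof of Thm. 4.6; this form: this work] -/
theorem clus_snd_subset_clus_kaMap_fst {x : Finset (Sym2 V) × Finset (Sym2 V)} {u : V}
    (hu : u ∉ clus D x.2 a) : clus D x.2 u ⊆ clus D (kaMap D a x).1 u :=
  clus_subset_clus_splice_compl (K := x.2) (ω := x.1) hu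

/-! ## 3. Events, the image property, and the inequalities -/

/-- Symmetry of cluster membership. [folklore] -/
theorem mem_clus_comm {K : Finset (Sym2 V)} {u v : V} (h : u ∈ clus D K v) : v ∈ clus D K u := by
  rw [clus_eq_clus_of_mem h]; exact mem_clus_self v

/-- The SOURCE event of `K_a`: in `C₂`, `y ∈ cl c ∌ a` and `b ∉ cl a`; in `C₁`, the three vertices `b, c, y` are pairwise
separated (`a` unconstrained).  It contains `{C₁ ∈ ab|c|y} × {C₂ ∈ a|b|cy}`. [this work] -/
def srcEvent (D : Finset (Sym2 V)) (a b c y : V) : Set (Finset (Sym2 V) × Finset (Sym2 V)) :=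
  {x | y ∈ clus D x.2 c ∧ a ∉ clus D x.2 c ∧ b ∉ clus D x.2 a ∧
      c ∉ clus D x.1 b ∧ y ∉ clus D x.1 b ∧ y ∉ clus D x.1 c}

/-- First target coordinate: `y ∈ cl c` (`c ↔ y`). [this work] -/
def cyFst (D : Finset (Sym2 V)) (c y : V) : Set (Finset (Sym2 V)) := {S | y ∈ clus D S c}

/-- Second target coordinate: `a, b, c, y` pairwise separated (the bottom cell `a|b|c|y`). [this work] -/
def botSnd (D : Finset (Sym2 V)) (a b c y : V) : Set (Finset (Sym2 V)) :=
  {S | b ∉ clus D S a ∧ c ∉ clus D S a ∧ y ∉ clus D S a ∧ c ∉ clus D S b ∧ y ∉ clus D S b ∧ y ∉ clus D S c}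

variable {b c y : V}

/-- **Image property of `K_a`**: the source event is mapped into `{c ↔ y} × {a|b|c|y}`. [this work] -/
theorem kaMap_mem_target {x : Finset (Sym2 V) × Finset (Sym2 V)} (hx : x ∈ srcEvent D a b c y) :
    kaMap D a x ∈ cyFst D c y ×ˢ botSnd D a b c y := by
  obtain ⟨hy2c, ha2c, hb2a, hc1b, hy1b, hy1c⟩ := hx
  have hc2a : c ∉ clus D x.2 a := fun h => ha2c (mem_clus_comm h)
  have hy2a : y ∉ clus D x.2 a := fun h =>
    ha2c (by rw [← clus_eq_clus_of_mem hy2c, clus_eq_clus_of_mem h]; exact mem_clus_self a)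
  have hfst : (kaMap D a x).1 ∈ cyFst D c y := clus_snd_subset_clus_kaMap_fst hc2a hy2c
  have hsnd : (kaMap D a x).2 ∈ botSnd D a b c y := by
    simp only [botSnd, Set.mem_setOf_eq, clus_kaMap_snd_a]
    exact ⟨hb2a, hc2a, hy2a, fun h => hc1b (mem_clus_fst_of_mem_clus_kaMap_snd hb2a h),
      fun h => hy1b (mem_clus_fst_of_mem_clus_kaMap_snd hb2a h),
      fun h => hy1c (mem_clus_fst_of_mem_clus_kaMap_snd hc2a h)⟩
  exact Set.mk_mem_prod hfst hsnd

/-- **The `K_a` inequality**: for every finite edge set with probabilities in `[0,1]`,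
`P⊗P(srcEvent) ≤ P(c ↔ y) · P(a|b|c|y)`; in cells, `[q + Sab + P(ac|b|y) + P(ay|b|c)]·[Scy + Ka] ≤ P(cy)·q`.
(At law level this is also Harris' inequality twice — odds of `{a isolated}` under `{b,c,y separated}` vs under
`{c ↔ y}`; recorded here as the image certificate of `K_a`.) [this work] -/
theorem Pr2W_src_le {p : Sym2 V → ℝ} (hp0 : ∀ e, 0 ≤ p e) (hp1 : ∀ e, p e ≤ 1) (a b c y : V) :
    Pr2W D p (srcEvent D a b c y) ≤ PrW D p (cyFst D c y) * PrW D p (botSnd D a b c y) := by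
  rw [← Pr2W_prod]
  refine Pr2W_le_of_injOn D hp0 hp1 (kaMap D a) _ _ (fun x _ _ => wt2W_kaMap p x)
    (fun x hx hxS => ⟨kaMap_mem_pairs hx, kaMap_mem_target hxS⟩) ?_
  exact fun x _ x' _ h => kaMap_injective h

/-! ### The two-map cascade `T0 ⊔ K_a` on the pairs of `W0` -/

/-- The class of `K_a` in the cascade: the cell `(acy|b ; a|b|c|y)` — in the first configuration `a, y ∈ cl c ∌ b`,
in the second all four vertices are separated. [this work] -/
def kbBotCell (D : Finset (Sym2 V)) (a b c y : V) : Set (Finset (Sym2 V) × Finset (Sym2 V)) :=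
  {S | a ∈ clus D S c ∧ y ∈ clus D S c ∧ b ∉ clus D S c} ×ˢ botSnd D a b c y

/-- The `T0` target (`(ab|cy ; c,y singletons)`, `a ∉ cl₃ c`) and the `K_a` class (`a ∈ cl₃ c`) are disjoint.
[this work] -/
theorem disjoint_targetEvent_kbBotCell (D : Finset (Sym2 V)) (a b c y : V) :
    Disjoint (targetEvent D a b c y) (kbBotCell D a b c y) := by
  rw [Set.disjoint_left]
  rintro z ⟨-, ha, -⟩ hz
  rw [kbBotCell, Set.mem_prod] at hz
  exact ha hz.1.1

/-- The `a`-SEPARABLE pairs: those whose `K_a`-image lies in the cell `(acy|b ; a|b|c|y)`. [this work] -/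
def aSepEvent (D : Finset (Sym2 V)) (a b c y : V) : Set (Finset (Sym2 V) × Finset (Sym2 V)) :=
  {x | kaMap D a x ∈ kbBotCell D a b c y}

/-- **Cascade `T0 ⊔ K_a` (all finite graphs).**  The pairs that are NON-HUB (handled by `T0`, gen 13) or
`a`-separable (handled by `K_a`) have total weight at most `P⊗P(targetEvent) + P⊗P(kbBotCell)`, i.e. at most
`P(ab|cy)·[P(∅)+P(ab|c|y)] + P(acy|b)·P(∅)` — the row `W0` holds for them with the `P(∅)·P(a|bcy)` term to spare.
What is left of `W0` for all `n` is the complementary class of hub pairs (memo §6). [this work] -/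
theorem Pr2W_nonHub_union_aSep_le {p : Sym2 V → ℝ} (hp0 : ∀ e, 0 ≤ p e) (hp1 : ∀ e, p e ≤ 1) (a b c y : V) :
    Pr2W D p (nonHubEvent D a b c y ∪ aSepEvent D a b c y) ≤
      Pr2W D p (targetEvent D a b c y) + Pr2W D p (kbBotCell D a b c y) := by
  rw [← Pr2W_union D p (disjoint_targetEvent_kbBotCell D a b c y)]
  refine Pr2W_le_of_two_maps D hp0 hp1 (t0Map D c y) (kaMap D a) _ _ _
    (disjoint_targetEvent_kbBotCell D a b c y) (wt2W_t0Map p) (wt2W_kaMap p)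
    (fun x hx => t0Map_mem_pairs hx) (fun x hx => kaMap_mem_pairs hx) t0Map_injective kaMap_injective ?_
  rintro x - (hx | hx)
  · exact Or.inl (t0Map_mem_target hx)
  · exact Or.inr hx

/-- The bound of the cascade in product form: `P⊗P(nonHub ∪ aSep) ≤ P(C₃ ∈ ab|cy)·P(c,y singletons) + P(C₃ ∈ acy|b)·P(⊥)`.
[this work] -/
theorem Pr2W_nonHub_union_aSep_le_mul {p : Sym2 V → ℝ} (hp0 : ∀ e, 0 ≤ p e) (hp1 : ∀ e, p e ≤ 1)
    (a b c y : V) :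
    Pr2W D p (nonHubEvent D a b c y ∪ aSepEvent D a b c y) ≤
      PrW D p (targetFst D a b c y) * PrW D p (targetSnd D a b c y) +
        PrW D p {S | a ∈ clus D S c ∧ y ∈ clus D S c ∧ b ∉ clus D S c} * PrW D p (botSnd D a b c y) := by
  have h := Pr2W_nonHub_union_aSep_le (D := D) hp0 hp1 a b c y
  rw [Pr2W_targetEvent_eq_mul, kbBotCell, Pr2W_prod] at h
  exact h

end Summit.CriticalPhenomena.PercolationContinuityZ3.Theorems.W0KeepClusterSwap

end
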